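import Summits.BirchSwinnertonDyer.BirchSwinnertonDyer.Theorems.KatoDescentTamePotSupersingularCartanMuRoadFukudaDoorsNoGrowth
import Literature.NumberTheory.IwasawaTheory.ClassicalMuInvariantOnePrimeProofs
import HarnessLib

/-!
# K9 / KT `p = 3` Cartan μ-road — the CLASS-NUMBER doors (Iwasawa 1956) and the WILD Fukuda U₀ doors with EVERY dischargeable named fact
# discharged: (A) at `(W,3)` / U₀ `MissingUpperBoundAt W 3` from «`3 ∤ h(ℚ(P))` and one prime of `ℚ(P)` above `3`» or from ONE integer equality
# on the tower of `ℚ(P) = ℚ(W[3])⁺`, modulo Ferrero–Washington ALONE (+ `hKatoA hGZK hmod` for U₀)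
# (cell `bsd-potss`, seat `bsd-potss-k8t-c4` g22; route-free; `--supports stmt-BirchSwinnertonDyer-19982 --as helper`; K9 doors as courtesy; closes nothing)

HONEST FRAMING. Route-free THEOREMS ONLY (no definition, no named fact, no `sorry`). k9-c4's `CartanMuRoadRealClassNumberDoors` (hCS hI hFW hIw),
`CartanMuRoadFukudaDoorsWild/F1/F2` (hCS hI hFW [hF1/hF2]) display named facts that are now tree theorems or unnecessary:
`iwasawa1956_classNumberPExp_eq_zero_of_not_dvd_classNumber_of_unique_prime_holds` (bsd-potss, `ClassicalMuInvariantOnePrimeProofs`),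
`fukuda1994_thm1_…_holds` (g19/g20), `CoatesSujatha2005.thm34_…_holds` (g22) and the hI-free doors `CartanMuRoadRealDoorsNoGrowth` /
`CartanMuRoadFukudaDoorsNoGrowth` (g22). THIS FILE: §1 class-number doors — (A) at `(W,3)` (any elliptic `W/ℚ`) and U₀ (tame (t′) / wild O6) from
`3 ∤ h(ℚ(P))` + «one prime above 3» (Iwasawa 1956 ⟹ `e_n = 0` ∀ n ⟹ `μ = 0`), modulo `hFW` only; §2 the WILD (O6) Fukuda U₀ doors (K9 courtesy; the tame ones
are in `CartanMuRoadFukudaDoorsNoGrowth`). Nothing is asserted about any curve; (A), Conjecture A and BSD are proved for no curve here.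
[cite: Greenberg2001IwasawaPastPresent, Prop. (2.1) (p. 339)] [cite: Fukuda1994, Thm. 1, p. 264] [cite: CoatesSujatha2005, Thm. 3.4 (§3)]
[cite: Kato2004Asterisque, Thm. 14.5 (3) (p. 236)] [cite: Serre1972, §2.4 Prop. 15, §5.2 (iv)] [cite: Washington1997, §13.1, §13.3 Prop. 13.23]
-/

set_option linter.dupNamespace false
set_option autoImplicit false

noncomputable section

open scoped Classical NumberField
open Field IntermediateField WeierstrassCurve Literature.NumberTheory.EllipticCurves
  Literature.NumberTheory.EllipticCurves.Rank1Residual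
  Literature.NumberTheory.EllipticCurves.Rank1Residual.Typed
  Literature.NumberTheory.GaloisRepresentations Literature.NumberTheory.SerreUniformity
  Literature.NumberTheory.IwasawaTheory
  Summit.BirchSwinnertonDyer.Rank1Residual Summit.BirchSwinnertonDyer.Rank1Residual.Additive

namespace Summit.BirchSwinnertonDyer.BirchSwinnertonDyer.Theorems.CartanMuRoadClassNumberFukudaDoorsNoGrowth

/-! ### §1 Class-number doors (Iwasawa 1956 PROVED), modulo Ferrero–Washington alone -/

section ClassNumber

variable (W : WeierstrassCurve ℚ) [W.IsElliptic]

/-- **(A) at `(W,3)` on a `3Ns` row from `3 ∤ h(ℚ(P))` and «one prime of `ℚ(P)` above `3`»** (Iwasawa 1956 PROVED ⟹ `e_n = 0` for all `n` ⟹ `μ = 0`),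
modulo Ferrero–Washington alone (`hCS` discharged, `hI` removed, `hIw` discharged). CONDITIONAL; (A) asserted for no curve.
[cite: Greenberg2001IwasawaPastPresent, Prop. (2.1) (p. 339)] [cite: CoatesSujatha2005, Thm. 3.4 (§3)] [cite: Serre1972, §5.2 (iv)] -/
theorem conjA_three_of_hasSplitCartanNormalizerModPImage_of_realClassNumber
    (hFW : ferreroWashington1979_classicalMuVanishes)
    (himg : HasSplitCartanNormalizerModPImage W 3) {c : absoluteGaloisGroup ℚ} (hc : IsComplexConjugation (Rat.castHom ℝ) c)
    (hh : haveI : NumberField ↥(W.divisionField 3) := NumberField.mk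
      ¬ 3 ∣ NumberField.classNumber ↥(fixedField (Subgroup.zpowers (absRestrictNormalHom (W.divisionField 3) c))))
    (hv : haveI : NumberField ↥(W.divisionField 3) := NumberField.mk
      ∃! v : IsDedekindDomain.HeightOneSpectrum (𝓞 ↥(fixedField (Subgroup.zpowers (absRestrictNormalHom (W.divisionField 3) c)))),
        ((3 : ℕ) : 𝓞 ↥(fixedField (Subgroup.zpowers (absRestrictNormalHom (W.divisionField 3) c)))) ∈ v.asIdeal)
    (κ : ZpExtension ℚ 3) (hκ : κ.IsCyclotomic) :
    ∃ (γ : absoluteGaloisGroup ℚ) (D : W.FineSelmerDualData κ γ),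
      Module.Finite ℤ_[3] (RestrictScalars ℤ_[3] (IwasawaAlgebra 3) D.X) :=
  haveI : NumberField ↥(W.divisionField 3) := NumberField.mk
  CartanMuRoadRealDoorsNoGrowth.conjA_three_of_hasSplitCartanNormalizerModPImage_of_realMu W hFW himg hc
    (fun κE _ => classicalMuVanishes_of_classNumberPExp_eq_zero
      iwasawa1956_classNumberPExp_eq_zero_of_not_dvd_classNumber_of_unique_prime_holds hh hv κE) κ hκ

/-- **(A) at `(W,3)` on a `3Nn` row from `3 ∤ h(ℚ(P))` and «one prime of `ℚ(P)` above `3`»** (Iwasawa 1956 PROVED ⟹ `e_n = 0` for all `n` ⟹ `μ = 0`),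
modulo Ferrero–Washington alone (`hCS` discharged, `hI` removed, `hIw` discharged). CONDITIONAL; (A) asserted for no curve.
[cite: Greenberg2001IwasawaPastPresent, Prop. (2.1) (p. 339)] [cite: CoatesSujatha2005, Thm. 3.4 (§3)] [cite: Serre1972, §5.2 (iv)] -/
theorem conjA_three_of_hasModPImageEqNonsplitCartanNormalizer_of_realClassNumber
    (hFW : ferreroWashington1979_classicalMuVanishes)
    (himg : HasModPImageEqNonsplitCartanNormalizer W 3) {c : absoluteGaloisGroup ℚ} (hc : IsComplexConjugation (Rat.castHom ℝ) c)
    (hh : haveI : NumberField ↥(W.divisionField 3) := NumberField.mk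
      ¬ 3 ∣ NumberField.classNumber ↥(fixedField (Subgroup.zpowers (absRestrictNormalHom (W.divisionField 3) c))))
    (hv : haveI : NumberField ↥(W.divisionField 3) := NumberField.mk
      ∃! v : IsDedekindDomain.HeightOneSpectrum (𝓞 ↥(fixedField (Subgroup.zpowers (absRestrictNormalHom (W.divisionField 3) c)))),
        ((3 : ℕ) : 𝓞 ↥(fixedField (Subgroup.zpowers (absRestrictNormalHom (W.divisionField 3) c)))) ∈ v.asIdeal)
    (κ : ZpExtension ℚ 3) (hκ : κ.IsCyclotomic) :
    ∃ (γ : absoluteGaloisGroup ℚ) (D : W.FineSelmerDualData κ γ),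
      Module.Finite ℤ_[3] (RestrictScalars ℤ_[3] (IwasawaAlgebra 3) D.X) :=
  haveI : NumberField ↥(W.divisionField 3) := NumberField.mk
  CartanMuRoadRealDoorsNoGrowth.conjA_three_of_hasModPImageEqNonsplitCartanNormalizer_of_realMu W hFW himg hc
    (fun κE _ => classicalMuVanishes_of_classNumberPExp_eq_zero
      iwasawa1956_classNumberPExp_eq_zero_of_not_dvd_classNumber_of_unique_prime_holds hh hv κE) κ hκ

end ClassNumber

section ClassNumberUpper

variable (W : WeierstrassCurve ℚ) [W.IsElliptic] [W.IsGloballyMinimal]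

/-- **U₀ at a `3Ns` (t′) row from `3 ∤ h(ℚ(P))` and «one prime of `ℚ(P)` above `3`»**, modulo `hKatoA hGZK hmod hFW` only (Iwasawa 1956,
Coates–Sujatha 3.4 discharged; no growth theorem). CONDITIONAL; nothing booked; BSD for no curve. [cite: Kato2004Asterisque, Thm. 14.5 (3) (p. 236)]
[cite: Greenberg2001IwasawaPastPresent, Prop. (2.1) (p. 339)] [cite: CoatesSujatha2005, Thm. 3.4 (§3)] -/
theorem missingUpperBoundAt_three_tame_of_hasSplitCartanNormalizerModPImage_of_realClassNumber
    (hKatoA : Kato2004.rankZero_padicValNat_sha_add_padicValNat_tamagawa_le_of_additive_potGood_of_irreducible_of_fineSelmerDual_fg)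
    (hGZK : rank_eq_analyticRank_of_analyticRank_le_one) (hmod : hasEntireLFunction_rat)
    (hFW : ferreroWashington1979_classicalMuVanishes) [Fact (3 : ℕ).Prime]
    (hr : W.analyticRank = 0) (hadd : Addv W 3) (hT : SubTprime W 3) (hirr : W.HasIrreducibleModPGaloisRep 3)
    (himg : HasSplitCartanNormalizerModPImage W 3) {c : absoluteGaloisGroup ℚ} (hc : IsComplexConjugation (Rat.castHom ℝ) c)
    (hh : haveI : NumberField ↥(W.divisionField 3) := NumberField.mk
      ¬ 3 ∣ NumberField.classNumber ↥(fixedField (Subgroup.zpowers (absRestrictNormalHom (W.divisionField 3) c))))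
    (hv : haveI : NumberField ↥(W.divisionField 3) := NumberField.mk
      ∃! v : IsDedekindDomain.HeightOneSpectrum (𝓞 ↥(fixedField (Subgroup.zpowers (absRestrictNormalHom (W.divisionField 3) c)))),
        ((3 : ℕ) : 𝓞 ↥(fixedField (Subgroup.zpowers (absRestrictNormalHom (W.divisionField 3) c)))) ∈ v.asIdeal) :
    MissingUpperBoundAt W 3 :=
  haveI : NumberField ↥(W.divisionField 3) := NumberField.mk
  CartanMuRoadRealDoorsNoGrowth.missingUpperBoundAt_three_tame_of_hasSplitCartanNormalizerModPImage_of_realMu W hKatoA hGZK hmod hFW hr hadd hT hirr himg hc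
    (fun κE _ => classicalMuVanishes_of_classNumberPExp_eq_zero
      iwasawa1956_classNumberPExp_eq_zero_of_not_dvd_classNumber_of_unique_prime_holds hh hv κE)

/-- **U₀ at a `3Ns` O6 row from `3 ∤ h(ℚ(P))` and «one prime of `ℚ(P)` above `3`»**, modulo `hKatoA hGZK hmod hFW` only (Iwasawa 1956,
Coates–Sujatha 3.4 discharged; no growth theorem). CONDITIONAL; nothing booked; BSD for no curve. [cite: Kato2004Asterisque, Thm. 14.5 (3) (p. 236)]
[cite: Greenberg2001IwasawaPastPresent, Prop. (2.1) (p. 339)] [cite: CoatesSujatha2005, Thm. 3.4 (§3)] -/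
theorem missingUpperBoundAt_three_wild_of_hasSplitCartanNormalizerModPImage_of_realClassNumber
    (hKatoA : Kato2004.rankZero_padicValNat_sha_add_padicValNat_tamagawa_le_of_additive_potGood_of_irreducible_of_fineSelmerDual_fg)
    (hGZK : rank_eq_analyticRank_of_analyticRank_le_one) (hmod : hasEntireLFunction_rat)
    (hFW : ferreroWashington1979_classicalMuVanishes) [Fact (3 : ℕ).Prime]
    (hr : W.analyticRank = 0) (hO : ClassO6 W 3) (hirr : W.HasIrreducibleModPGaloisRep 3)
    (himg : HasSplitCartanNormalizerModPImage W 3) {c : absoluteGaloisGroup ℚ} (hc : IsComplexConjugation (Rat.castHom ℝ) c)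
    (hh : haveI : NumberField ↥(W.divisionField 3) := NumberField.mk
      ¬ 3 ∣ NumberField.classNumber ↥(fixedField (Subgroup.zpowers (absRestrictNormalHom (W.divisionField 3) c))))
    (hv : haveI : NumberField ↥(W.divisionField 3) := NumberField.mk
      ∃! v : IsDedekindDomain.HeightOneSpectrum (𝓞 ↥(fixedField (Subgroup.zpowers (absRestrictNormalHom (W.divisionField 3) c)))),
        ((3 : ℕ) : 𝓞 ↥(fixedField (Subgroup.zpowers (absRestrictNormalHom (W.divisionField 3) c)))) ∈ v.asIdeal) :
    MissingUpperBoundAt W 3 :=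
  haveI : NumberField ↥(W.divisionField 3) := NumberField.mk
  CartanMuRoadRealDoorsNoGrowth.missingUpperBoundAt_three_wild_of_hasSplitCartanNormalizerModPImage_of_realMu W hKatoA hGZK hmod hFW hr hO hirr himg hc
    (fun κE _ => classicalMuVanishes_of_classNumberPExp_eq_zero
      iwasawa1956_classNumberPExp_eq_zero_of_not_dvd_classNumber_of_unique_prime_holds hh hv κE)

/-- **U₀ at a `3Nn` (t′) row from `3 ∤ h(ℚ(P))` and «one prime of `ℚ(P)` above `3`»**, modulo `hKatoA hGZK hmod hFW` only (Iwasawa 1956,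
Coates–Sujatha 3.4 discharged; no growth theorem). CONDITIONAL; nothing booked; BSD for no curve. [cite: Kato2004Asterisque, Thm. 14.5 (3) (p. 236)]
[cite: Greenberg2001IwasawaPastPresent, Prop. (2.1) (p. 339)] [cite: CoatesSujatha2005, Thm. 3.4 (§3)] -/
theorem missingUpperBoundAt_three_tame_of_hasModPImageEqNonsplitCartanNormalizer_of_realClassNumber
    (hKatoA : Kato2004.rankZero_padicValNat_sha_add_padicValNat_tamagawa_le_of_additive_potGood_of_irreducible_of_fineSelmerDual_fg)
    (hGZK : rank_eq_analyticRank_of_analyticRank_le_one) (hmod : hasEntireLFunction_rat)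
    (hFW : ferreroWashington1979_classicalMuVanishes) [Fact (3 : ℕ).Prime]
    (hr : W.analyticRank = 0) (hadd : Addv W 3) (hT : SubTprime W 3) (hirr : W.HasIrreducibleModPGaloisRep 3)
    (himg : HasModPImageEqNonsplitCartanNormalizer W 3) {c : absoluteGaloisGroup ℚ} (hc : IsComplexConjugation (Rat.castHom ℝ) c)
    (hh : haveI : NumberField ↥(W.divisionField 3) := NumberField.mk
      ¬ 3 ∣ NumberField.classNumber ↥(fixedField (Subgroup.zpowers (absRestrictNormalHom (W.divisionField 3) c))))
    (hv : haveI : NumberField ↥(W.divisionField 3) := NumberField.mk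
      ∃! v : IsDedekindDomain.HeightOneSpectrum (𝓞 ↥(fixedField (Subgroup.zpowers (absRestrictNormalHom (W.divisionField 3) c)))),
        ((3 : ℕ) : 𝓞 ↥(fixedField (Subgroup.zpowers (absRestrictNormalHom (W.divisionField 3) c)))) ∈ v.asIdeal) :
    MissingUpperBoundAt W 3 :=
  haveI : NumberField ↥(W.divisionField 3) := NumberField.mk
  CartanMuRoadRealDoorsNoGrowth.missingUpperBoundAt_three_tame_of_hasModPImageEqNonsplitCartanNormalizer_of_realMu W hKatoA hGZK hmod hFW hr hadd hT hirr himg hc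
    (fun κE _ => classicalMuVanishes_of_classNumberPExp_eq_zero
      iwasawa1956_classNumberPExp_eq_zero_of_not_dvd_classNumber_of_unique_prime_holds hh hv κE)

/-- **U₀ at a `3Nn` O6 row from `3 ∤ h(ℚ(P))` and «one prime of `ℚ(P)` above `3`»**, modulo `hKatoA hGZK hmod hFW` only (Iwasawa 1956,
Coates–Sujatha 3.4 discharged; no growth theorem). CONDITIONAL; nothing booked; BSD for no curve. [cite: Kato2004Asterisque, Thm. 14.5 (3) (p. 236)]
[cite: Greenberg2001IwasawaPastPresent, Prop. (2.1) (p. 339)] [cite: CoatesSujatha2005, Thm. 3.4 (§3)] -/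
theorem missingUpperBoundAt_three_wild_of_hasModPImageEqNonsplitCartanNormalizer_of_realClassNumber
    (hKatoA : Kato2004.rankZero_padicValNat_sha_add_padicValNat_tamagawa_le_of_additive_potGood_of_irreducible_of_fineSelmerDual_fg)
    (hGZK : rank_eq_analyticRank_of_analyticRank_le_one) (hmod : hasEntireLFunction_rat)
    (hFW : ferreroWashington1979_classicalMuVanishes) [Fact (3 : ℕ).Prime]
    (hr : W.analyticRank = 0) (hO : ClassO6 W 3) (hirr : W.HasIrreducibleModPGaloisRep 3)
    (himg : HasModPImageEqNonsplitCartanNormalizer W 3) {c : absoluteGaloisGroup ℚ} (hc : IsComplexConjugation (Rat.castHom ℝ) c)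
    (hh : haveI : NumberField ↥(W.divisionField 3) := NumberField.mk
      ¬ 3 ∣ NumberField.classNumber ↥(fixedField (Subgroup.zpowers (absRestrictNormalHom (W.divisionField 3) c))))
    (hv : haveI : NumberField ↥(W.divisionField 3) := NumberField.mk
      ∃! v : IsDedekindDomain.HeightOneSpectrum (𝓞 ↥(fixedField (Subgroup.zpowers (absRestrictNormalHom (W.divisionField 3) c)))),
        ((3 : ℕ) : 𝓞 ↥(fixedField (Subgroup.zpowers (absRestrictNormalHom (W.divisionField 3) c)))) ∈ v.asIdeal) :
    MissingUpperBoundAt W 3 :=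
  haveI : NumberField ↥(W.divisionField 3) := NumberField.mk
  CartanMuRoadRealDoorsNoGrowth.missingUpperBoundAt_three_wild_of_hasModPImageEqNonsplitCartanNormalizer_of_realMu W hKatoA hGZK hmod hFW hr hO hirr himg hc
    (fun κE _ => classicalMuVanishes_of_classNumberPExp_eq_zero
      iwasawa1956_classNumberPExp_eq_zero_of_not_dvd_classNumber_of_unique_prime_holds hh hv κE)

end ClassNumberUpper

/-! ### §2 K9 (courtesy): the WILD Fukuda U₀ doors — ONE integer equality on the tower of `ℚ(P)`, modulo `hKatoA hGZK hmod hFW` only -/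

section FukudaUpperWild

variable (W : WeierstrassCurve ℚ) [W.IsElliptic] [W.IsGloballyMinimal]

/-- **U₀ at a `3Ns` O6 row from `ord₃ h(ℚ(P)_{n+1}) = ord₃ h(ℚ(P)_n)`** (Fukuda PROVED), modulo `hKatoA hGZK hmod hFW` only (Coates–Sujatha 3.4 discharged, no growth theorem;
K9 twin of `CartanMuRoadFukudaDoorsNoGrowth.missingUpperBoundAt_three_tame_of_hasSplitCartanNormalizerModPImage_of_realSuccEqAt`). CONDITIONAL; nothing booked; BSD for no curve.
[cite: Kato2004Asterisque, Thm. 14.5 (3) (p. 236)] [cite: Fukuda1994, Thm. 1 (1), p. 264] [cite: CoatesSujatha2005, Thm. 3.4 (§3)] -/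
theorem missingUpperBoundAt_three_wild_of_hasSplitCartanNormalizerModPImage_of_realSuccEqAt
    (hKatoA : Kato2004.rankZero_padicValNat_sha_add_padicValNat_tamagawa_le_of_additive_potGood_of_irreducible_of_fineSelmerDual_fg)
    (hGZK : rank_eq_analyticRank_of_analyticRank_le_one) (hmod : hasEntireLFunction_rat)
    (hFW : ferreroWashington1979_classicalMuVanishes) [Fact (3 : ℕ).Prime]
    (hr : W.analyticRank = 0) (hO : ClassO6 W 3) (hirr : W.HasIrreducibleModPGaloisRep 3)
    (himg : HasSplitCartanNormalizerModPImage W 3) {c : absoluteGaloisGroup ℚ} (hc : IsComplexConjugation (Rat.castHom ℝ) c) (n : ℕ)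
    (hord : ∀ κE : ZpExtension ↥(fixedField (Subgroup.zpowers (absRestrictNormalHom (W.divisionField 3) c))) 3,
      κE.IsCyclotomic → classNumberPExp κE (n + 1) = classNumberPExp κE n) :
    MissingUpperBoundAt W 3 := by
  haveI : NumberField ↥(W.divisionField 3) := NumberField.mk
  exact CartanMuRoadRealDoorsNoGrowth.missingUpperBoundAt_three_wild_of_hasSplitCartanNormalizerModPImage_of_realMu W hKatoA hGZK hmod hFW hr hO hirr himg hc
    (fun κE hκE => classicalMuVanishes_of_classNumberPExp_succ_eq fukuda1994_thm1_classNumberPExp_const_of_succ_eq_holds κE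
      (CartanMuRoadFukudaDoorsTprime.totallyRamifiedFrom_zero_intermediateField_divisionField W 3 hirr
        (CartanMuRoadFukudaDoorsTprime.not_hasSurjectiveModNGaloisRep_of_hasSplitCartanNormalizerModPImage W himg) _ κE hκE)
      (Nat.zero_le n) (hord κE hκE))

/-- **U₀ at a `3Ns` O6 row from `rank₃ Cl(ℚ(P)_{n+1}) = rank₃ Cl(ℚ(P)_n)`** (Fukuda PROVED), modulo `hKatoA hGZK hmod hFW` only (Coates–Sujatha 3.4 discharged, no growth theorem;
K9 twin of `CartanMuRoadFukudaDoorsNoGrowth.missingUpperBoundAt_three_tame_of_hasSplitCartanNormalizerModPImage_of_realRankSuccEqAt`). CONDITIONAL; nothing booked; BSD for no curve.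
[cite: Kato2004Asterisque, Thm. 14.5 (3) (p. 236)] [cite: Fukuda1994, Thm. 1 (2), p. 264] [cite: CoatesSujatha2005, Thm. 3.4 (§3)] -/
theorem missingUpperBoundAt_three_wild_of_hasSplitCartanNormalizerModPImage_of_realRankSuccEqAt
    (hKatoA : Kato2004.rankZero_padicValNat_sha_add_padicValNat_tamagawa_le_of_additive_potGood_of_irreducible_of_fineSelmerDual_fg)
    (hGZK : rank_eq_analyticRank_of_analyticRank_le_one) (hmod : hasEntireLFunction_rat)
    (hFW : ferreroWashington1979_classicalMuVanishes) [Fact (3 : ℕ).Prime]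
    (hr : W.analyticRank = 0) (hO : ClassO6 W 3) (hirr : W.HasIrreducibleModPGaloisRep 3)
    (himg : HasSplitCartanNormalizerModPImage W 3) {c : absoluteGaloisGroup ℚ} (hc : IsComplexConjugation (Rat.castHom ℝ) c) (n : ℕ)
    (hrk : ∀ κE : ZpExtension ↥(fixedField (Subgroup.zpowers (absRestrictNormalHom (W.divisionField 3) c))) 3,
      κE.IsCyclotomic → classGroupPRank κE (n + 1) = classGroupPRank κE n) :
    MissingUpperBoundAt W 3 := by
  haveI : NumberField ↥(W.divisionField 3) := NumberField.mk
  exact CartanMuRoadRealDoorsNoGrowth.missingUpperBoundAt_three_wild_of_hasSplitCartanNormalizerModPImage_of_realMu W hKatoA hGZK hmod hFW hr hO hirr himg hc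
    (fun κE hκE => classicalMuVanishes_of_classGroupPRank_succ_eq fukuda1994_thm1_classGroupPRank_const_of_succ_eq_holds κE
      (CartanMuRoadFukudaDoorsTprime.totallyRamifiedFrom_zero_intermediateField_divisionField W 3 hirr
        (CartanMuRoadFukudaDoorsTprime.not_hasSurjectiveModNGaloisRep_of_hasSplitCartanNormalizerModPImage W himg) _ κE hκE)
      (Nat.zero_le n) (hrk κE hκE))

/-- **U₀ at a `3Nn` O6 row from `ord₃ h(ℚ(P)_{n+1}) = ord₃ h(ℚ(P)_n)`** (Fukuda PROVED), modulo `hKatoA hGZK hmod hFW` only (Coates–Sujatha 3.4 discharged, no growth theorem;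
K9 twin of `CartanMuRoadFukudaDoorsNoGrowth.missingUpperBoundAt_three_tame_of_hasModPImageEqNonsplitCartanNormalizer_of_realSuccEqAt`). CONDITIONAL; nothing booked; BSD for no curve.
[cite: Kato2004Asterisque, Thm. 14.5 (3) (p. 236)] [cite: Fukuda1994, Thm. 1 (1), p. 264] [cite: CoatesSujatha2005, Thm. 3.4 (§3)] -/
theorem missingUpperBoundAt_three_wild_of_hasModPImageEqNonsplitCartanNormalizer_of_realSuccEqAt
    (hKatoA : Kato2004.rankZero_padicValNat_sha_add_padicValNat_tamagawa_le_of_additive_potGood_of_irreducible_of_fineSelmerDual_fg)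
    (hGZK : rank_eq_analyticRank_of_analyticRank_le_one) (hmod : hasEntireLFunction_rat)
    (hFW : ferreroWashington1979_classicalMuVanishes) [Fact (3 : ℕ).Prime]
    (hr : W.analyticRank = 0) (hO : ClassO6 W 3) (hirr : W.HasIrreducibleModPGaloisRep 3)
    (himg : HasModPImageEqNonsplitCartanNormalizer W 3) {c : absoluteGaloisGroup ℚ} (hc : IsComplexConjugation (Rat.castHom ℝ) c) (n : ℕ)
    (hord : ∀ κE : ZpExtension ↥(fixedField (Subgroup.zpowers (absRestrictNormalHom (W.divisionField 3) c))) 3,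
      κE.IsCyclotomic → classNumberPExp κE (n + 1) = classNumberPExp κE n) :
    MissingUpperBoundAt W 3 := by
  haveI : NumberField ↥(W.divisionField 3) := NumberField.mk
  exact CartanMuRoadRealDoorsNoGrowth.missingUpperBoundAt_three_wild_of_hasModPImageEqNonsplitCartanNormalizer_of_realMu W hKatoA hGZK hmod hFW hr hO hirr himg hc
    (fun κE hκE => classicalMuVanishes_of_classNumberPExp_succ_eq fukuda1994_thm1_classNumberPExp_const_of_succ_eq_holds κE
      (CartanMuRoadFukudaDoorsTprime.totallyRamifiedFrom_zero_intermediateField_divisionField W 3 hirr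
        (not_hasSurjectiveModNGaloisRep_of_hasNonsplitCartanModPImage W himg.hasNonsplitCartanModPImage) _ κE hκE)
      (Nat.zero_le n) (hord κE hκE))

/-- **U₀ at a `3Nn` O6 row from `rank₃ Cl(ℚ(P)_{n+1}) = rank₃ Cl(ℚ(P)_n)`** (Fukuda PROVED), modulo `hKatoA hGZK hmod hFW` only (Coates–Sujatha 3.4 discharged, no growth theorem;
K9 twin of `CartanMuRoadFukudaDoorsNoGrowth.missingUpperBoundAt_three_tame_of_hasModPImageEqNonsplitCartanNormalizer_of_realRankSuccEqAt`). CONDITIONAL; nothing booked; BSD for no curve.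
[cite: Kato2004Asterisque, Thm. 14.5 (3) (p. 236)] [cite: Fukuda1994, Thm. 1 (2), p. 264] [cite: CoatesSujatha2005, Thm. 3.4 (§3)] -/
theorem missingUpperBoundAt_three_wild_of_hasModPImageEqNonsplitCartanNormalizer_of_realRankSuccEqAt
    (hKatoA : Kato2004.rankZero_padicValNat_sha_add_padicValNat_tamagawa_le_of_additive_potGood_of_irreducible_of_fineSelmerDual_fg)
    (hGZK : rank_eq_analyticRank_of_analyticRank_le_one) (hmod : hasEntireLFunction_rat)
    (hFW : ferreroWashington1979_classicalMuVanishes) [Fact (3 : ℕ).Prime]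
    (hr : W.analyticRank = 0) (hO : ClassO6 W 3) (hirr : W.HasIrreducibleModPGaloisRep 3)
    (himg : HasModPImageEqNonsplitCartanNormalizer W 3) {c : absoluteGaloisGroup ℚ} (hc : IsComplexConjugation (Rat.castHom ℝ) c) (n : ℕ)
    (hrk : ∀ κE : ZpExtension ↥(fixedField (Subgroup.zpowers (absRestrictNormalHom (W.divisionField 3) c))) 3,
      κE.IsCyclotomic → classGroupPRank κE (n + 1) = classGroupPRank κE n) :
    MissingUpperBoundAt W 3 := by
  haveI : NumberField ↥(W.divisionField 3) := NumberField.mk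
  exact CartanMuRoadRealDoorsNoGrowth.missingUpperBoundAt_three_wild_of_hasModPImageEqNonsplitCartanNormalizer_of_realMu W hKatoA hGZK hmod hFW hr hO hirr himg hc
    (fun κE hκE => classicalMuVanishes_of_classGroupPRank_succ_eq fukuda1994_thm1_classGroupPRank_const_of_succ_eq_holds κE
      (CartanMuRoadFukudaDoorsTprime.totallyRamifiedFrom_zero_intermediateField_divisionField W 3 hirr
        (not_hasSurjectiveModNGaloisRep_of_hasNonsplitCartanModPImage W himg.hasNonsplitCartanModPImage) _ κE hκE)
      (Nat.zero_le n) (hrk κE hκE))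

end FukudaUpperWild

end Summit.BirchSwinnertonDyer.BirchSwinnertonDyer.Theorems.CartanMuRoadClassNumberFukudaDoorsNoGrowth

end
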